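import Literature.MathematicalPhysics.QuantumFieldTheory.Balaban1983to89.B11Eq98V0LettersFlatLevels
import Summits.QuantumFields.YangMills.Theorems.BalabanUVNodesK0Stub1V0SlotAtRecord

/-!
# BalabanUVNodes ∕ K0⁷ stub 1 (`stub_prop8StepCoP13`), sub-target S4b — [Balaban1985Variational] Prop. 4's V₀-group current at the flat background ON THE
# SETUP TORUS with the MULTI-LEVEL weights `(L^{j(b₋)}·L^{−k})^m` of a collared domain sequence (the cube-sequence (144) reading of the sizes (115))

Cell `pub-ymgap`, width seat `pub-ymgap-k0-s1-w2` (g0; HUMAN RULING D-0149), K0⁷ **stmt-QuantumFields-20541**; `--kind proof --supports stmt-QuantumFields-20541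
--as helper`; count-neutral.  [15] = T. Bałaban, CMP **102** (1985) 277–309.

WHY.  `Thm/BalabanUVNodesK0Stub1V0SlotAtRecord.exists_W_V0_flat` (this seat, p587784) serves the V₀ summand of Sect. F's (158) map `W` at ONE level (weight
`c = L^k`).  Sect. F reads the sizes on the cube sequence (144) with level-dependent weights; the route `UnitScaleTilt`'s `FlatSmallSolution158Levels` and
k0-s1-w1's `existsUnique_smallSolution158_recordDom` (p584325) take `W` with the weights `w m b = (L^{levOf Ω k b₋}·L^{−k})^m` on the bond letters, the
pair letters `w 2 b·L^k·‖Y⟨b₋ + e_ν, dir b⟩ − Y b‖` and the current letter `w 3 b·‖W Y b‖`.  The V₀-group slot on those weights is this seat's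
`B11Eq98V0LettersFlatLevels.quadAnalytic_curV0_flat_levOf` (p586870; `Λ = L²` from the one-step oscillation of `levOf` under a one-step collar).  THIS FILE
transports it along the site dictionary: for a domain sequence `Ω` on `Site P 0` with a ONE-STEP COLLAR (`x ∈ Ω_{j+1} ⇒ x ± e_ν ∈ Ω_j`, the one-step form
of (144) «dist(□_{n+1}, □_nᶜ) = R₁M₁Lⁿη») the transported sequence `e⁻¹-preimage` has the TSite collar, its `levOf` is the transported `levOf`, and the weights
agree bond by bond.

CONTENTS (theorems only; 0 `def`).  §1 `levOf_transport` (`rfl`), `collar_transport`.  §2 ★★ `exists_W_V0_flat_levOf` — `∃ e W`: dictionary law, DEFINING EQUATION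
(`W Y b = curV0 ρ τ 1 (Y ∘ e⁻¹) (e b₋, dir b)` on the `levOf` weights of the transported sequence), the WEIGHTED `hWq` at `a₃ = 1/16` with
`C₄ = 64(d−1)L⁶‖ρ‖ + (d−1)L⁶(136+2L²)‖ρ‖‖τ‖`, `Differentiable ℂ W`, the (63)∕(27) certificate at `torusT P 0`, flat datum; `exists_W_V0_flat_levOf_of_letterBound`
(letter bounds ⇒ `C₄ = (d−1)·L⁶·M_ρ·(200+2L²)`; at `M_N(ℂ)`: `M_ρ = N³` by `Thm/BalabanUVNodesK0Stub1FibreTraceLetters.exists_fibreLetters`).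

HONEST FRAMING.  Transport∕bookkeeping of kernel theorems; V₀-group ONLY; the identification of the tree's cube sequence ∕ (2.18) sequences with the one-step
collar is the consumer's (k0-s1-w3's `Sect2.SeqSeparated.shift_mem∕unshift_mem`, UST's `cubeSeq` separation); K0⁷ OPEN; N07 NOT discharged; counts unmoved
(5∕27); one finite 𝕋⁴ programme at fixed ε — R4 closes the conditional rung `BalabanLadder.UV` only; the YM mass gap (Clay) is NOT proved by any of this;
nothing continuum ∕ ℝ⁴ ∕ OS.  0 `sorry`, 0 `def`, 0 `instance`, standard axioms.
-/

noncomputable section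

namespace Summit.QuantumFields.YangMills.Theorems.K0Stub1V0SlotAtRecordLevels

open Literature.MathematicalPhysics.QuantumFieldTheory.Balaban1983to89
open B4Sect5Torus (TSite)
open B9SectCLatticeCarrier (Bond)
open B11Eq115Space
open B11Eq111FrakG (nabla115)
open Summit.QuantumFields.YangMills.Theorems.K0Stub1V0SlotAtRecord

/-! ## §1 Level maps under the site dictionary -/

section LevOf

variable {P : Params} (e : Site P 0 ≃ TSite P.d (fun _ => P.sitesPerDir 0))

open Classical in
/-- The level map of the transported domain sequence is the transported level map (`rfl`). [cite: Balaban1985Variational, p.286, (115) p.294] -/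
theorem levOf_transport (Ω : ℕ → Set (Site P 0)) (k : ℕ) (y : TSite P.d (fun _ => P.sitesPerDir 0)) :
    levOf (fun j => e.symm ⁻¹' Ω j) k y = levOf Ω k (e.symm y) := rfl

/-- A Setup-side one-step collar transports to the TSite-side collar hypothesis of `quadAnalytic_curV0_flat_levOf`. [cite: Balaban1985Variational, (144) p.300] -/
theorem collar_transport (he : ∀ (x : Site P 0) (μ : Fin P.d), e (x.shift μ) = B9SectCLatticeCarrier.shift μ (e x))
    (Ω : ℕ → Set (Site P 0))
    (hcollar : ∀ (j : ℕ) (x : Site P 0) (ν : Fin P.d), x ∈ Ω (j + 1) → x.shift ν ∈ Ω j ∧ x.unshift ν ∈ Ω j)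
    (j : ℕ) (y : TSite P.d (fun _ => P.sitesPerDir 0)) (ν : Fin P.d) (hy : y ∈ e.symm ⁻¹' Ω (j + 1)) :
    B11Eq90V0primeCurrent.Tsh ν y ∈ e.symm ⁻¹' Ω j ∧ (B11Eq90V0primeCurrent.Tsh ν).symm y ∈ e.symm ⁻¹' Ω j := by
  have h := hcollar j (e.symm y) ν hy
  refine ⟨?_, ?_⟩
  · show e.symm (B9SectCLatticeCarrier.shift ν y) ∈ Ω j
    rw [dict_symm_shift e he]; exact h.1
  · show e.symm (B9SectCLatticeCarrier.unshift ν y) ∈ Ω j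
    rw [dict_symm_unshift e he]; exact h.2

end LevOf


/-! ## §2 The V₀-group current on the Setup torus with the MULTI-LEVEL weights `(L^{j(b₋)}·L^{−k})^m` of a collared domain sequence -/

section Slot

variable {P : Params}
variable {𝔸 : Type*} [NormedRing 𝔸] [NormedAlgebra ℂ 𝔸] [CompleteSpace 𝔸] [NormOneClass 𝔸] [StarRing 𝔸] [StarModule ℂ 𝔸]
  [FiniteDimensional ℂ 𝔸]

open B11Eq63V0GroupCurrent (curV0 bondPair_curV0)
open B11Eq90V0primeCurrent (Tsh Ucur curL curL_apply differentiable_curV0prime)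
open B11Eq96CommutatorCurrent (differentiable_curComm)
open B11Eq98V0LettersFlatLevels (quadAnalytic_curV0_flat_levOf)
open B11Eq26ActionExpansion (V0)
open B9Eq39Adjoint (bondPair)

/-- **THE V₀-GROUP's `(δ/δA)V₀` AT THE FLAT BACKGROUND ON THE SETUP TORUS, MULTI-LEVEL WEIGHTS** — the reading of the route `UnitScaleTilt`'s
`FlatSmallSolution158Levels` ∕ k0-s1-w1's `existsUnique_smallSolution158_recordDom` (weights `w m b = (L^{j(b₋)}·L^{−k})^m`, `j = levOf Ω k`, pairs `(b, ν)`,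
difference `Y⟨b₋ + e_ν, dir b⟩ − Y b` weighted by `w 2 b·L^k`): for a domain sequence `Ω` on `Site P 0` with a ONE-STEP COLLAR (`x ∈ Ω_{j+1} ⇒ x ± e_ν ∈ Ω_j`,
the one-step form of (144)), every `k`, every complete unital f.d. `*`-algebra and letters `ρ, τ`: there are a dictionary `e` and a map `W` with the DEFINING
EQUATION `W Y b = curV0 ρ τ 1 (Y ∘ e⁻¹) (e b₋, dir b)` (lit-balaban's current on the `levOf` weights of the transported sequence), the weighted `hWq` at `a₃ = 1/16`
with `C₄ = 64(d−1)L⁶‖ρ‖ + (d−1)L⁶(136+2L²)‖ρ‖‖τ‖` (`Λ = L²`, `B11Eq98V0LettersFlatLevels.quadAnalytic_curV0_flat_levOf`), `Differentiable ℂ W`, and the (63)∕(27)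
certificate at `torusT P 0`, flat datum. [cite: Balaban1985Variational, (98) p.293, (115) p.294, (144) p.300, (158) p.302, (63) p.287] -/
theorem exists_W_V0_flat_levOf (P : Params) (hd : 4 ≤ P.d) (k : ℕ) [Fact ((0 : ℝ) < (P.L : ℝ))] [Fact ((0 : ℝ) < ((P.L : ℝ))⁻¹ ^ k)]
    (Ω : ℕ → Set (Site P 0))
    (hcollar : ∀ (j : ℕ) (x : Site P 0) (ν : Fin P.d), x ∈ Ω (j + 1) → x.shift ν ∈ Ω j ∧ x.unshift ν ∈ Ω j)
    (w : ℕ → PBond P 0 → ℝ) (hw : ∀ m b, w m b = ((P.L : ℝ) ^ levOf Ω k b.src * ((P.L : ℝ)⁻¹) ^ k) ^ m)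
    (ρ : (𝔸 →L[ℂ] ℂ) →L[ℂ] 𝔸) (τ : 𝔸 →L[ℂ] ℂ) (hρ : ∀ (ℓ : 𝔸 →L[ℂ] ℂ) (X : 𝔸), τ (ρ ℓ * X) = ℓ X)
    (hτ : ∀ a b : 𝔸, τ (a * b) = τ (b * a)) (hτs : ∀ a : 𝔸, τ (star a) = starRingEnd ℂ (τ a)) (hτ1 : ∀ X : 𝔸, ‖τ X‖ ≤ ‖X‖) :
    ∃ (e : Site P 0 ≃ TSite P.d (fun _ => P.sitesPerDir 0)) (W : (PBond P 0 → 𝔸) → (PBond P 0 → 𝔸)),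
      (∀ (x : Site P 0) (μ : Fin P.d), e (x.shift μ) = B9SectCLatticeCarrier.shift μ (e x)) ∧
      (∀ (Y : PBond P 0 → 𝔸) (b : PBond P 0), W Y b =
        NegSup.equiv _ 𝔸 (curV0 (L := (P.L : ℝ)) (η := ((P.L : ℝ))⁻¹ ^ k)
          (lev₀ := fun b' : Bond P.d (fun _ => P.sitesPerDir 0) => levOf (fun j => e.symm ⁻¹' Ω j) k b'.1)
          (lev₁ := fun p : Bond P.d (fun _ => P.sitesPerDir 0) × Fin P.d => levOf (fun j => e.symm ⁻¹' Ω j) k p.1.1)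
          (Dc := nabla115 (((P.L : ℝ))⁻¹ ^ k) (1 : Bond P.d (fun _ => P.sitesPerDir 0) → 𝔸ˣ)) ρ τ 1
          ((JetSup.equiv _ _ _).symm fun b' => Y ⟨e.symm b'.1, b'.2⟩)) (e b.src, b.dir)) ∧
      (∀ (Y : PBond P 0 → 𝔸) (r : ℝ), r < 1 / 16 → (∀ b, w 1 b * ‖Y b‖ ≤ r) →
        (∀ (b : PBond P 0) (ν : Fin P.d), w 2 b * (P.L : ℝ) ^ k * ‖Y ⟨b.src.shift ν, b.dir⟩ - Y b‖ ≤ r) →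
        ∀ b, w 3 b * ‖W Y b‖ ≤
          (64 * ((P.d - 1 : ℕ) : ℝ) * ((P.L : ℝ) ^ 2) ^ 3 * ‖ρ‖
            + ((P.d - 1 : ℕ) : ℝ) * ((P.L : ℝ) ^ 2) ^ 3 * (136 + 2 * (P.L : ℝ) ^ 2) * ‖ρ‖ * ‖τ‖) * r ^ 2) ∧
      Differentiable ℂ W ∧
      (∀ (Y δ : PBond P 0 → 𝔸),
        bondPair (((P.L : ℝ))⁻¹ ^ k) P.d (τ : 𝔸 →ₗ[ℂ] ℂ) (fun μ x => W Y ⟨x, μ⟩) (fun μ x => δ ⟨x, μ⟩)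
          = deriv (fun t : ℂ => V0 (LatticeFieldCalculus.shiftEquiv (P := P) (j := 0)) (fun _ _ => (1 : 𝔸ˣ))
              (((P.L : ℝ))⁻¹ ^ k) P.d (τ : 𝔸 →ₗ[ℂ] ℂ) ((fun μ x => Y ⟨x, μ⟩) + t • fun μ x => δ ⟨x, μ⟩)) 0) := by
  classical
  obtain ⟨e, he⟩ := exists_siteDictionary P 0
  have hL : (0 : ℝ) < (P.L : ℝ) := by exact_mod_cast P.L_pos
  have hL1 : (1 : ℝ) ≤ (P.L : ℝ) := by exact_mod_cast P.hL.2.le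
  let Pd : Fin P.d → ℕ := fun _ => P.sitesPerDir 0
  let η : ℝ := ((P.L : ℝ))⁻¹ ^ k
  have hη : 0 < η := pow_pos (inv_pos.mpr hL) k
  let Ω' : ℕ → Set (TSite P.d Pd) := fun j => e.symm ⁻¹' Ω j
  let lev₀ : Bond P.d Pd → ℕ := fun b' => levOf Ω' k b'.1
  let lev₁ : Bond P.d Pd × Fin P.d → ℕ := fun p => levOf Ω' k p.1.1
  let Dc := nabla115 η (1 : Bond P.d Pd → 𝔸ˣ)
  let eY := JetSup.equiv (𝕜 := ℂ) (V := 𝔸) (levWeight (P.L : ℝ) η lev₀ 1) (levWeight (P.L : ℝ) η lev₁ 2) Dc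
  let eZ := NegSup.equiv (levWeight (P.L : ℝ) η lev₀ 3) 𝔸
  -- the weights agree along the dictionary
  have hwt : ∀ (m : ℕ) (y : TSite P.d Pd) (μ : Fin P.d),
      levWeight (P.L : ℝ) η (fun b' : Bond P.d Pd => levOf Ω' k b'.1) m (y, μ) = w m ⟨e.symm y, μ⟩ := fun m y μ => by
    rw [levWeight_apply, hw]; rfl
  have hwt1 : ∀ (y : TSite P.d Pd) (μ ν : Fin P.d),
      levWeight (P.L : ℝ) η lev₁ 2 ((y, μ), ν) = w 2 ⟨e.symm y, ν⟩ := fun y μ ν => by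
    rw [levWeight_apply, hw]; rfl
  -- transport in ∕ out
  let Tinₗ : (PBond P 0 → 𝔸) →ₗ[ℂ] Space115 (P.L : ℝ) η lev₀ lev₁ Dc :=
    { toFun := fun Y => eY.symm fun b' => Y ⟨e.symm b'.1, b'.2⟩
      map_add' := fun Y Z => rfl
      map_smul' := fun c Y => rfl }
  let Tin : (PBond P 0 → 𝔸) →L[ℂ] Space115 (P.L : ℝ) η lev₀ lev₁ Dc := LinearMap.toContinuousLinearMap Tinₗ
  let Toutₗ : NegSize (P.L : ℝ) η lev₀ 3 𝔸 →ₗ[ℂ] (PBond P 0 → 𝔸) :=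
    { toFun := fun F b => eZ F (e b.src, b.dir)
      map_add' := fun F G => rfl
      map_smul' := fun c F => rfl }
  let Tout : NegSize (P.L : ℝ) η lev₀ 3 𝔸 →L[ℂ] (PBond P 0 → 𝔸) := LinearMap.toContinuousLinearMap Toutₗ
  let cur := curV0 (L := (P.L : ℝ)) (η := η) (lev₀ := lev₀) (lev₁ := lev₁) (Dc := Dc) ρ τ 1
  -- the (115)-size of a transported field from the weighted pointwise letters
  have hTin : ∀ (Y : PBond P 0 → 𝔸) (r : ℝ), 0 ≤ r → (∀ b, w 1 b * ‖Y b‖ ≤ r) →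
      (∀ (b : PBond P 0) (ν : Fin P.d), w 2 b * (P.L : ℝ) ^ k * ‖Y ⟨b.src.shift ν, b.dir⟩ - Y b‖ ≤ r) → ‖Tin Y‖ ≤ r := by
    intro Y r hr h0 h1
    rw [JetSup.norm_le_iff_pointwise hr]
    refine ⟨fun b' => ?_, fun p => ?_⟩
    · obtain ⟨y, μ⟩ := b'
      rw [hwt]
      exact h0 ⟨e.symm y, μ⟩
    · obtain ⟨⟨y, μ⟩, ν⟩ := p
      show levWeight (P.L : ℝ) η lev₁ 2 ((y, μ), ν) *
          ‖nabla115 η (1 : Bond P.d Pd → 𝔸ˣ) (fun b' : Bond P.d Pd => Y ⟨e.symm b'.1, b'.2⟩) ((y, μ), ν)‖ ≤ r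
      rw [hwt1, nabla115_one_apply, norm_smul, norm_inv, Complex.norm_real, Real.norm_of_nonneg hη.le]
      have hs : e.symm (B9SectCLatticeCarrier.btgt (y, μ)) = (e.symm y).shift μ := dict_symm_shift e he y μ
      have hηinv : (η : ℝ)⁻¹ = (P.L : ℝ) ^ k := by
        show (((P.L : ℝ))⁻¹ ^ k)⁻¹ = (P.L : ℝ) ^ k
        rw [inv_pow, inv_inv]
      rw [hs, hηinv, ← mul_assoc]
      exact h1 ⟨e.symm y, ν⟩ μ
  -- the (63)/(27) certificate on the lit-balaban carrier
  have cert : ∀ (Y δ : PBond P 0 → 𝔸),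
      bondPair η P.d (τ : 𝔸 →ₗ[ℂ] ℂ) (curL fun b' : Bond P.d Pd => Tout (cur (Tin Y)) ⟨e.symm b'.1, b'.2⟩)
          (curL fun b' : Bond P.d Pd => δ ⟨e.symm b'.1, b'.2⟩)
        = deriv (fun t : ℂ => V0 Tsh (Ucur (1 : Bond P.d Pd → 𝔸ˣ)) η P.d (τ : 𝔸 →ₗ[ℂ] ℂ)
            ((curL fun b' : Bond P.d Pd => Y ⟨e.symm b'.1, b'.2⟩) + t • curL fun b' : Bond P.d Pd => δ ⟨e.symm b'.1, b'.2⟩)) 0 := by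
    intro Y δ
    have hW : (fun b' : Bond P.d Pd => Tout (cur (Tin Y)) ⟨e.symm b'.1, b'.2⟩) = eZ (cur (Tin Y)) := by
      funext b'
      show eZ (cur (Tin Y)) (e (e.symm b'.1), b'.2) = eZ (cur (Tin Y)) b'
      rw [Equiv.apply_symm_apply]
    rw [hW]
    exact bondPair_curV0 (lev₁ := lev₁) (Dc := Dc) ρ τ hρ hτ hd 1 (Tin Y) (fun b' => δ ⟨e.symm b'.1, b'.2⟩)
  have heT : ∀ (μ : Fin P.d) (x : Site P 0), e (LatticeFieldCalculus.shiftEquiv (P := P) (j := 0) μ x) = Tsh μ (e x) :=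
    fun μ x => he x μ
  refine ⟨e, fun Y => Tout (cur (Tin Y)), he, fun Y b => rfl, ?_, ?_, ?_⟩
  · intro Y r hr h0 h1 b
    have hne : Nonempty (PBond P 0) := ⟨⟨default, ⟨0, P.hd⟩⟩⟩
    have hwpos : ∀ m b, 0 < w m b := fun m b => by rw [hw]; positivity
    have hr0 : 0 ≤ r := le_trans (mul_nonneg (hwpos 1 b).le (norm_nonneg _)) (h0 b)
    have hT : ‖Tin Y‖ ≤ r := hTin Y r hr0 h0 h1
    have hlt : ‖Tin Y‖ < 1 / 16 := lt_of_le_of_lt hT hr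
    have hq := (quadAnalytic_curV0_flat_levOf (d := P.d) (Pd := Pd) (L := (P.L : ℝ)) (η := η) ρ τ hτ hτs hτ1 hL1 Ω' k
      (fun j y ν hy => collar_transport e he Ω hcollar j y ν hy)).quad (Tin Y) hlt
    have hC : 0 ≤ 64 * ((P.d - 1 : ℕ) : ℝ) * ((P.L : ℝ) ^ 2) ^ 3 * ‖ρ‖
        + ((P.d - 1 : ℕ) : ℝ) * ((P.L : ℝ) ^ 2) ^ 3 * (136 + 2 * (P.L : ℝ) ^ 2) * ‖ρ‖ * ‖τ‖ := by positivity
    have hw3 : w 3 b = levWeight (P.L : ℝ) η lev₀ 3 (e b.src, b.dir) := by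
      rw [hwt]; simp only [Equiv.symm_apply_apply]
    calc w 3 b * ‖Tout (cur (Tin Y)) b‖ = levWeight (P.L : ℝ) η lev₀ 3 (e b.src, b.dir) * ‖eZ (cur (Tin Y)) (e b.src, b.dir)‖ := by
          rw [hw3]; rfl
      _ ≤ ‖cur (Tin Y)‖ := NegSup.weight_mul_norm_apply_le _ _
      _ ≤ _ := hq
      _ ≤ _ := by gcongr
  · have hcur : Differentiable ℂ cur :=
      (differentiable_curV0prime (lev₁ := lev₁) (Dc := Dc) ρ τ 1).add (differentiable_curComm (lev₁ := lev₁) (Dc := Dc) ρ τ 1)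
    exact Tout.differentiable.comp (hcur.comp Tin.differentiable)
  · intro Y δ
    calc bondPair η P.d (τ : 𝔸 →ₗ[ℂ] ℂ) (fun μ x => Tout (cur (Tin Y)) ⟨x, μ⟩) (fun μ x => δ ⟨x, μ⟩)
        = bondPair η P.d (τ : 𝔸 →ₗ[ℂ] ℂ) (fun κ y => (fun μ x => Tout (cur (Tin Y)) ⟨x, μ⟩) κ (e.symm y))
            (fun κ y => (fun μ x => δ ⟨x, μ⟩) κ (e.symm y)) :=
          (bondPair_transport e η P.d (τ : 𝔸 →ₗ[ℂ] ℂ) _ _).symm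
      _ = bondPair η P.d (τ : 𝔸 →ₗ[ℂ] ℂ) (curL fun b' : Bond P.d Pd => Tout (cur (Tin Y)) ⟨e.symm b'.1, b'.2⟩)
            (curL fun b' : Bond P.d Pd => δ ⟨e.symm b'.1, b'.2⟩) := rfl
      _ = _ := cert Y δ
      _ = _ := by
          congr 1
          funext t
          exact V0_transport (LatticeFieldCalculus.shiftEquiv (P := P) (j := 0)) Tsh e heT (fun _ _ => (1 : 𝔸ˣ)) η hη.ne' hd
            (τ : 𝔸 →ₗ[ℂ] ℂ) hτ ((fun μ x => Y ⟨x, μ⟩) + t • fun μ x => δ ⟨x, μ⟩)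

/-- **THE MULTI-LEVEL SLOT WITH A NUMERICAL CONSTANT FROM LETTER BOUNDS**: if `‖ρ(ℓ)‖ ≤ M_ρ‖ℓ‖` and `τ` is contractive then `exists_W_V0_flat_levOf`'s
constant is at most `(d − 1)·L⁶·M_ρ·(200 + 2L²)` (`‖ρ‖ ≤ M_ρ`, `‖τ‖ ≤ 1`); at the record's fibre `M_N(ℂ)` take `(τ, ρ, M_ρ) = (τ_N, ρ_N, N³)` from
`Thm/BalabanUVNodesK0Stub1FibreTraceLetters.exists_fibreLetters`. [cite: Balaban1985Variational, (98) p.293] -/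
theorem exists_W_V0_flat_levOf_of_letterBound (P : Params) (hd : 4 ≤ P.d) (k : ℕ) [Fact ((0 : ℝ) < (P.L : ℝ))]
    [Fact ((0 : ℝ) < ((P.L : ℝ))⁻¹ ^ k)] (Ω : ℕ → Set (Site P 0))
    (hcollar : ∀ (j : ℕ) (x : Site P 0) (ν : Fin P.d), x ∈ Ω (j + 1) → x.shift ν ∈ Ω j ∧ x.unshift ν ∈ Ω j)
    (w : ℕ → PBond P 0 → ℝ) (hw : ∀ m b, w m b = ((P.L : ℝ) ^ levOf Ω k b.src * ((P.L : ℝ)⁻¹) ^ k) ^ m)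
    (ρ : (𝔸 →L[ℂ] ℂ) →L[ℂ] 𝔸) (τ : 𝔸 →L[ℂ] ℂ) (hρ : ∀ (ℓ : 𝔸 →L[ℂ] ℂ) (X : 𝔸), τ (ρ ℓ * X) = ℓ X)
    (hτ : ∀ a b : 𝔸, τ (a * b) = τ (b * a)) (hτs : ∀ a : 𝔸, τ (star a) = starRingEnd ℂ (τ a)) (hτ1 : ∀ X : 𝔸, ‖τ X‖ ≤ ‖X‖)
    {Mρ : ℝ} (hMρ : 0 ≤ Mρ) (hρb : ∀ ℓ, ‖ρ ℓ‖ ≤ Mρ * ‖ℓ‖) :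
    ∃ (e : Site P 0 ≃ TSite P.d (fun _ => P.sitesPerDir 0)) (W : (PBond P 0 → 𝔸) → (PBond P 0 → 𝔸)),
      (∀ (x : Site P 0) (μ : Fin P.d), e (x.shift μ) = B9SectCLatticeCarrier.shift μ (e x)) ∧
      (∀ (Y : PBond P 0 → 𝔸) (r : ℝ), r < 1 / 16 → (∀ b, w 1 b * ‖Y b‖ ≤ r) →
        (∀ (b : PBond P 0) (ν : Fin P.d), w 2 b * (P.L : ℝ) ^ k * ‖Y ⟨b.src.shift ν, b.dir⟩ - Y b‖ ≤ r) →
        ∀ b, w 3 b * ‖W Y b‖ ≤ (((P.d - 1 : ℕ) : ℝ) * (P.L : ℝ) ^ 6 * Mρ * (200 + 2 * (P.L : ℝ) ^ 2)) * r ^ 2) ∧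
      Differentiable ℂ W ∧
      (∀ (Y δ : PBond P 0 → 𝔸),
        bondPair (((P.L : ℝ))⁻¹ ^ k) P.d (τ : 𝔸 →ₗ[ℂ] ℂ) (fun μ x => W Y ⟨x, μ⟩) (fun μ x => δ ⟨x, μ⟩)
          = deriv (fun t : ℂ => V0 (LatticeFieldCalculus.shiftEquiv (P := P) (j := 0)) (fun _ _ => (1 : 𝔸ˣ))
              (((P.L : ℝ))⁻¹ ^ k) P.d (τ : 𝔸 →ₗ[ℂ] ℂ) ((fun μ x => Y ⟨x, μ⟩) + t • fun μ x => δ ⟨x, μ⟩)) 0) := by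
  obtain ⟨e, W, he, -, hq, hdiff, hcert⟩ := exists_W_V0_flat_levOf (𝔸 := 𝔸) P hd k Ω hcollar w hw ρ τ hρ hτ hτs hτ1
  have hτn : ‖τ‖ ≤ 1 := ContinuousLinearMap.opNorm_le_bound τ zero_le_one fun X => by rw [one_mul]; exact hτ1 X
  have hρN : ‖ρ‖ ≤ Mρ := ContinuousLinearMap.opNorm_le_bound ρ hMρ hρb
  have hL : (0 : ℝ) ≤ (P.L : ℝ) := by exact_mod_cast P.L_pos.le
  refine ⟨e, W, he, fun Y r hr h0 h1 b => ?_, hdiff, hcert⟩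
  calc w 3 b * ‖W Y b‖ ≤ (64 * ((P.d - 1 : ℕ) : ℝ) * ((P.L : ℝ) ^ 2) ^ 3 * ‖ρ‖
            + ((P.d - 1 : ℕ) : ℝ) * ((P.L : ℝ) ^ 2) ^ 3 * (136 + 2 * (P.L : ℝ) ^ 2) * ‖ρ‖ * ‖τ‖) * r ^ 2 := hq Y r hr h0 h1 b
    _ ≤ (64 * ((P.d - 1 : ℕ) : ℝ) * ((P.L : ℝ) ^ 2) ^ 3 * Mρ
            + ((P.d - 1 : ℕ) : ℝ) * ((P.L : ℝ) ^ 2) ^ 3 * (136 + 2 * (P.L : ℝ) ^ 2) * Mρ * 1) * r ^ 2 := by gcongr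
    _ = (((P.d - 1 : ℕ) : ℝ) * (P.L : ℝ) ^ 6 * Mρ * (200 + 2 * (P.L : ℝ) ^ 2)) * r ^ 2 := by ring

end Slot

end Summit.QuantumFields.YangMills.Theorems.K0Stub1V0SlotAtRecordLevels

end
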